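import Summits.AtomisticToContinuum.HydrodynamicLimit.Theorems.AntiMazurCoboundariesCellForecastPressureDecayEnskogObjects
import Literature.Analysis.FluidPDE.HardSphereCollisionRecord
import HarnessLib

/-!
# Objects of the crux line `enskog-compensator-martingale`, part B: the short-time cluster tail
# (crux `CellForecastPressureDecay`, stmt-AtomisticToContinuum-13915; route AntiMazurCoboundaries, rank 6)

Second objects module of the line (lead `prover-line-stmt-AtomisticToContinuum-13915-c2-0`, 2026-08-16), written
by the S2d stub-worker of wave 1 and reviewed by the lead. Wave 1 landed the statics S2a (`stub_cellLawFactorises`,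
p102145), S2b (`stub_contactLayerBounds`, p112420 + p105342) and eight pieces of the kinematic assembly S2d
(`…KinematicAssembly{NoCollision,Cylinder,PairExchange,ClusterEnergy,Displacement,IsolatedPair,MainTerm,FreshPair}`,
p113574–p119784), and found that the assembly `S2a → S2b → S2c → KinematicRates σ` hinges on one short-time DYNAMICAL
estimate that the static hypotheses cannot supply (a sphere can be struck by a sphere carrying the kinetic energy of
an arbitrarily large earlier cluster, so no static 3-label event with radii in three initial speeds contains the bad
event; all cluster sizes must be summed — a Lanford-type short-time cluster estimate under the canonical cell law):
the obligation `ClusterTail σ` below (registered stub `stub_clusterTail`, S2e of skeleton v3), with its vocabulary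
`IsFreeIn`, `IsIsolatedPair`, `InCylinder` matching the hypotheses of the landed pieces. The lead's reshape:
`stub_kinematicAssemblyOfTail : … → ClusterTail σ → KinematicRates σ` (S2d′) replaces S2d.
-/

noncomputable section

open MeasureTheory ProbabilityTheory Set Filter
open scoped ENNReal BigOperators InnerProductSpace
open Literature.Analysis.FluidPDE Literature.MathematicalPhysics.KineticTheory

namespace Summit.AtomisticToContinuum.HydrodynamicLimit.Theorems.EnskogCompensator

/-- Sphere `i` is FREE in the slab: it takes part in no collision at the times of `(0, Δ]`. -/
def IsFreeIn {σ : ℝ} {n : ℕ} (Ψ : Flows σ) (Δ : ℝ) (z : Cell n) (i : Fin n) : Prop :=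
  ∀ s ∈ Set.Ioc 0 Δ, ¬ Participates (Euclidean.geometry (Fin 3)) σ ((Ψ n).flow s z) i

/-- The pair `{i, j}` is ISOLATED in the slab: every collision of `i` is with `j` and conversely
(the hypotheses of `stub_kinematicAssembly_isolatedPair`). -/
def IsIsolatedPair {σ : ℝ} {n : ℕ} (Ψ : Flows σ) (Δ : ℝ) (z : Cell n) (i j : Fin n) : Prop :=
  i ≠ j ∧ (∀ s ∈ Set.Ioc 0 Δ, ∀ k, Collide (Euclidean.geometry (Fin 3)) σ ((Ψ n).flow s z) i k → k = j) ∧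
    ∀ s ∈ Set.Ioc 0 Δ, ∀ k, Collide (Euclidean.geometry (Fin 3)) σ ((Ψ n).flow s z) j k → k = i

/-- The initial relative data of `(i, j)` lie in the collision cylinder of the slab (the support of the static
pair functional of `stub_kinematicAssembly_mainTerm`). -/
def InCylinder (σ Δ : ℝ) {n : ℕ} (z : Cell n) (i j : Fin n) : Prop :=
  ∃ (ω : Metric.sphere (0 : V3) 1) (t : ℝ), t ∈ Set.Ioc 0 Δ ∧ inner ℝ (ω : V3) ((z i).2 - (z j).2) < 0 ∧
    (z i).1 - (z j).1 = σ • (ω : V3) - t • ((z i).2 - (z j).2)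

open Classical in
/-- **S2e · `ClusterTail σ` — the short-time cluster tail of the cell law**: for `Δ ≤ δ₀`, `L ≥ L₀`, `n ≤ 2L³` and every cluster dynamics,
(a) the expected number of spheres that are neither free nor in an isolated pair of the slab `(0, Δ]`, and
(b) the expected number of ordered pairs whose initial data lie in the collision cylinder of the slab but which are
NOT an isolated pair, are both `≤ C (L³Δ² + L²Δ)`. -/
def ClusterTail (σ : ℝ) : Prop :=
  ∃ C : ℝ, 0 ≤ C ∧ ∃ δ₀ : ℝ, 0 < δ₀ ∧ ∃ L₀ : ℝ, 0 < L₀ ∧ ∀ L : ℝ, L₀ ≤ L → ∀ n : ℕ, (n : ℝ) ≤ 2 * L ^ 3 →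
    ∀ Ψ : Flows σ, ∀ Δ : ℝ, 0 < Δ → Δ ≤ δ₀ →
      (∫⁻ z, ((Finset.univ.filter fun i : Fin n =>
          ¬ (IsFreeIn Ψ Δ z i ∨ ∃ j, IsIsolatedPair Ψ Δ z i j)).card : ℝ≥0∞) ∂(cellLaw σ L n Ψ) ≤
        ENNReal.ofReal (C * (L ^ 3 * Δ ^ 2 + L ^ 2 * Δ))) ∧
      (∫⁻ z, ((Finset.univ.filter fun p : Fin n × Fin n =>
          p.1 ≠ p.2 ∧ InCylinder σ Δ z p.1 p.2 ∧ ¬ IsIsolatedPair Ψ Δ z p.1 p.2).card : ℝ≥0∞) ∂(cellLaw σ L n Ψ) ≤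
        ENNReal.ofReal (C * (L ^ 3 * Δ ^ 2 + L ^ 2 * Δ)))


/-! ## API and the registered bookkeeping stub of this module -/

/-- A free sphere participates in no collision of the slab (unfolding lemma). [folklore] -/
theorem isFreeIn_iff {σ : ℝ} {n : ℕ} (Ψ : Flows σ) (Δ : ℝ) (z : Cell n) (i : Fin n) :
    IsFreeIn Ψ Δ z i ↔ ∀ s ∈ Set.Ioc 0 Δ, ¬ Participates (Euclidean.geometry (Fin 3)) σ ((Ψ n).flow s z) i :=
  Iff.rfl

/-- An isolated pair consists of two distinct labels (projection). [folklore] -/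
theorem IsIsolatedPair.ne {σ : ℝ} {n : ℕ} {Ψ : Flows σ} {Δ : ℝ} {z : Cell n} {i j : Fin n}
    (h : IsIsolatedPair Ψ Δ z i j) : i ≠ j :=
  h.1

/-- Membership in the collision cylinder (unfolding lemma). [folklore] -/
theorem inCylinder_iff (σ Δ : ℝ) {n : ℕ} (z : Cell n) (i j : Fin n) :
    InCylinder σ Δ z i j ↔ ∃ (ω : Metric.sphere (0 : V3) 1) (t : ℝ), t ∈ Set.Ioc 0 Δ ∧
      inner ℝ (ω : V3) ((z i).2 - (z j).2) < 0 ∧ (z i).1 - (z j).1 = σ • (ω : V3) - t • ((z i).2 - (z j).2) :=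
  Iff.rfl

/-- **Registered bookkeeping stub `stub_enskogObjectsB`** of the line `enskog-compensator-martingale` (crux
stmt-AtomisticToContinuum-13915): the unfolding of `IsFreeIn` and of `InCylinder`, and `IsIsolatedPair → i ≠ j`.
[folklore] -/
theorem stub_enskogObjectsB :
    (∀ (σ : ℝ) (n : ℕ) (Ψ : Flows σ) (Δ : ℝ) (z : Cell n) (i : Fin n),
      IsFreeIn Ψ Δ z i ↔ ∀ s ∈ Set.Ioc 0 Δ, ¬ Participates (Euclidean.geometry (Fin 3)) σ ((Ψ n).flow s z) i) ∧
    (∀ (σ : ℝ) (n : ℕ) (Ψ : Flows σ) (Δ : ℝ) (z : Cell n) (i j : Fin n), IsIsolatedPair Ψ Δ z i j → i ≠ j) ∧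
    (∀ (σ Δ : ℝ) (n : ℕ) (z : Cell n) (i j : Fin n),
      InCylinder σ Δ z i j ↔ ∃ (ω : Metric.sphere (0 : V3) 1) (t : ℝ), t ∈ Set.Ioc 0 Δ ∧
        inner ℝ (ω : V3) ((z i).2 - (z j).2) < 0 ∧ (z i).1 - (z j).1 = σ • (ω : V3) - t • ((z i).2 - (z j).2)) :=
  ⟨fun _ _ Ψ Δ z i => isFreeIn_iff Ψ Δ z i, fun _ _ _ _ _ _ _ h => h.ne, fun σ Δ _ z i j => inCylinder_iff σ Δ z i j⟩

end Summit.AtomisticToContinuum.HydrodynamicLimit.Theorems.EnskogCompensator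

end
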